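import Mathlib
import HarnessLib
import Summits.HubbardSuperconductivity.HubbardSuperconductivity.Theorems.WeakCouplingBCSWcbcsKohnLuttingerB1gFormAWindow
import Summits.HubbardSuperconductivity.HubbardSuperconductivity.Theorems.ChiralWindowCwKLChiralWindowBlockBounds
import Summits.HubbardSuperconductivity.HubbardSuperconductivity.Theorems.WeakCouplingBCSDefsKlCertB1gT

/-!
# Route `WeakCouplingBCS` — support item `WcbcsKohnLuttingerB1g` (stmt-HubbardSuperconductivity-0158):
# TWO-SIDED enclosure of the `B1g` bottom on a window record (form (A)), generic in the record

The window records of the certificate half (form (A): theorem modulo the named enclosures) give SELECTION and a certified UPPER bound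
`channelInf ε₀ μ 1 B1g ≤ -a` (`klb1gd_window_b1g_le`, `Theorems/WeakCouplingBCSWcbcsKohnLuttingerB1gFormAWindow.lean`), i.e. a LOWER
bound `a` on the Kohn–Luttinger coupling `-channelInf ε₀ μ 1 B1g` whose inverse sets the onset scale of the leaf `H1TwoPointLimitKLOnsetD`.
This file adds the other side, for records whose `B1g` block also carries Temple/far rows (hypothesis `KLCert.EnclosuresB1gT` =
E1–E4 of all five blocks, `Theorems/WeakCouplingBCSDefsKlCertB1gT.lean`):

* `klb1gt_enclosuresB1g_of_T` — `EnclosuresB1gT → EnclosuresB1g` for records accepted by `checkB1gD` (so everything proved from the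
  window records — selection, attraction — is available from the two-sided records as well);
* `klb1gt_window_b1g_ge` — if every box's `B1g` block has `lowerOK` (Temple or far-channel data) with `lower ≥ L` (a kernel decision),
  then `L ≤ channelInf ε₀ μ 1 B1g` on the record's window: cover logic + the tree's block-level soundness `stub_klBlockBounds` read in
  the channel `B1g` (no new analysis);
* `klb1gt_window_two_sided`, `klb1gt_window_two_sided_U` — hence `-K ≤ channelInf ε₀ μ 1 B1g ≤ -a` on the window and, by the
  `U²`-homogeneity of the mean-zero `B1g` channel, `-K U² ≤ channelInf ε₀ μ U B1g ≤ -a U²` for every real `U`.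

The per-record instantiations (kernel decisions on the two-sided window records, the δ-form on the doping window of record and the
explicit onset constant) are in the companion file `…KohnLuttingerB1gTwoSidedWindow.lean`.
References: M. Reed, B. Simon, *Methods of Modern Mathematical Physics IV*, Thm. XIII.5 (Temple); S. Raghu, S. A. Kivelson,
D. J. Scalapino, Phys. Rev. B 81 (2010) 224505, §II (7), (13).
-/

noncomputable section

-- the tree's namespace `Summit.<Summit>.<Problem>.Theorems` repeats the summit name by design (D-0017)
set_option linter.dupNamespace false

namespace Summit.HubbardSuperconductivity.HubbardSuperconductivity.Theorems

open MeasureTheory Literature.MathematicalPhysics.QuantumLattice CwKLChiralWindow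
open Summit.HubbardSuperconductivity.HubbardSuperconductivity.Theses.WeakCouplingBCS

/-! ### From the five-block enclosures to the item's hypothesis -/

/-- The block of `B1g` is the field `bB1g`. [folklore] -/
theorem klb1gt_blk_B1g (bx : KLBox) : bx.blk D4Irrep.B1g = bx.bB1g := rfl

/-- **`EnclosuresB1gT` implies `EnclosuresB1g`** for a record accepted by the multiplicity-aware checker: the `B1g` block of every box
has `useTrial = true` (part of `ritzOK` in `basicOKB1gD`), so rows E1–E2 of its `Enclosure` are its `RitzEnclosure`; the four other
blocks' enclosures are taken verbatim. [folklore] -/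
theorem klb1gt_enclosuresB1g_of_T (c : KLCert) (hc : c.checkB1gD = true) (hT : c.EnclosuresB1gT) : c.EnclosuresB1g := by
  obtain ⟨-, hboxes, -⟩ := klb1gd_coverLogic c hc
  intro bx hbx μ hμ
  refine ⟨?_, fun χ _ => hT bx hbx μ hμ χ⟩
  have hB := (hboxes bx hbx).1
  simp only [KLBox.basicOKB1gD, KLBlock.ritzOK, Bool.and_eq_true, decide_eq_true_eq] at hB
  obtain ⟨⟨⟨⟨⟨-, ⟨⟨⟨⟨⟨⟨⟨hut, -⟩, -⟩, -⟩, -⟩, -⟩, -⟩, -⟩⟩, -⟩, -⟩, -⟩, -⟩ := hB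
  have hE := hT bx hbx μ hμ D4Irrep.B1g
  rw [klb1gt_blk_B1g] at hE
  obtain ⟨h1, h2, h3, h4, -⟩ := hE.1 hut
  exact ⟨h1, h2, h3, h4⟩

/-! ### The certified LOWER bound of the `B1g` bottom on a window record -/

/-- **`B1g` lower bound, uniformly on a window record.** If the record is accepted by the multiplicity-aware checker, the five-block
enclosures hold, and on every box the `B1g` block carries a certified lower bound (`lowerOK`: Temple data or far-channel data) which is
`≥ L` (a kernel decision), then `L ≤ channelInf ε₀ μ 1 B1g` for every `μ ∈ [c.mub, c.mua]` (cover logic + the tree's block-level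
soundness `stub_klBlockBounds` in the channel `B1g`). [cite: ReedSimonIV1978, Thm. XIII.5] -/
theorem klb1gt_window_b1g_ge (c : KLCert) (hc : c.checkB1gD = true) (hT : c.EnclosuresB1gT) (L : ℚ)
    (hL : (c.boxes.all fun bx => bx.bB1g.lowerOK c.trials D4Irrep.B1g && decide (L ≤ bx.bB1g.lower c.trials D4Irrep.B1g)) = true) :
    ∀ μ ∈ Set.Icc ((c.mub : ℚ) : ℝ) ((c.mua : ℚ) : ℝ),
      ((L : ℚ) : ℝ) ≤ channelInf (squareDispersion 1 0) μ 1 D4Irrep.B1g := by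
  obtain ⟨-, hboxes, hcover⟩ := klb1gd_coverLogic c hc
  intro μ hμ
  obtain ⟨bx, hbx, hlo, hhi⟩ := hcover μ hμ.1 hμ.2
  have hB := (hboxes bx hbx).1
  simp only [KLBox.basicOKB1gD, Bool.and_eq_true, decide_eq_true_eq] at hB
  obtain ⟨⟨⟨⟨⟨⟨⟨hb4, -⟩, hb0⟩, -⟩, -⟩, -⟩, -⟩, -⟩ := hB
  have hμ' : μ ∈ Set.Ioo (-4 : ℝ) 0 :=
    ⟨lt_of_lt_of_le (by exact_mod_cast hb4) hlo, lt_of_le_of_lt hhi (by exact_mod_cast hb0)⟩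
  have hLb := List.all_eq_true.1 hL bx hbx
  simp only [Bool.and_eq_true, decide_eq_true_eq] at hLb
  obtain ⟨hlow, hLle⟩ := hLb
  have hE := hT bx hbx μ ⟨hlo, hhi⟩ D4Irrep.B1g
  rw [klb1gt_blk_B1g] at hE
  have h := (stub_klBlockBounds μ hμ' bx.bB1g c.trials D4Irrep.B1g hE).1 hlow
  exact le_trans (by exact_mod_cast hLle) h

/-- **Two-sided enclosure of the `B1g` bottom, uniformly on a window record**: with the kernel decisions «every box's `B1g` Ritz row has
`rhohi ≤ -a`» and «every box's `B1g` block has a certified lower bound `≥ -K`», for every `μ ∈ [c.mub, c.mua]`,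
`-K ≤ channelInf ε₀ μ 1 B1g ≤ -a`, i.e. the Kohn–Luttinger coupling `-channelInf ε₀ μ 1 B1g` lies in `[a, K]`.
[cite: ReedSimonIV1978, Thm. XIII.5] -/
theorem klb1gt_window_two_sided (c : KLCert) (hc : c.checkB1gD = true) (hT : c.EnclosuresB1gT) (a K : ℚ)
    (ha : (c.boxes.all fun bx => decide (bx.bB1g.rhohi ≤ -a)) = true)
    (hK : (c.boxes.all fun bx => bx.bB1g.lowerOK c.trials D4Irrep.B1g && decide (-K ≤ bx.bB1g.lower c.trials D4Irrep.B1g)) = true) :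
    ∀ μ ∈ Set.Icc ((c.mub : ℚ) : ℝ) ((c.mua : ℚ) : ℝ),
      -((K : ℚ) : ℝ) ≤ channelInf (squareDispersion 1 0) μ 1 D4Irrep.B1g ∧
        channelInf (squareDispersion 1 0) μ 1 D4Irrep.B1g ≤ -((a : ℚ) : ℝ) := by
  intro μ hμ
  refine ⟨?_, klb1gd_window_b1g_le c hc (klb1gt_enclosuresB1g_of_T c hc hT) a ha μ hμ⟩
  have h := klb1gt_window_b1g_ge c hc hT (-K) hK μ hμ
  push_cast at h
  exact h

/-- **`U²`-scaling of the two-sided enclosure**: on a window record as above, for every real `U` and every `μ ∈ [c.mub, c.mua]`,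
`-K·U² ≤ channelInf ε₀ μ U B1g ≤ -a·U²` (`U²`-homogeneity of the mean-zero `B1g` channel, `klhs_channelInf_sq`).
[cite: RaghuKivelsonScalapino2010, §II (7) and (13)] -/
theorem klb1gt_window_two_sided_U (c : KLCert) (hc : c.checkB1gD = true) (hT : c.EnclosuresB1gT) (a K : ℚ)
    (ha : (c.boxes.all fun bx => decide (bx.bB1g.rhohi ≤ -a)) = true)
    (hK : (c.boxes.all fun bx => bx.bB1g.lowerOK c.trials D4Irrep.B1g && decide (-K ≤ bx.bB1g.lower c.trials D4Irrep.B1g)) = true) :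
    ∀ μ ∈ Set.Icc ((c.mub : ℚ) : ℝ) ((c.mua : ℚ) : ℝ), ∀ U : ℝ,
      -((K : ℚ) : ℝ) * U ^ 2 ≤ channelInf (squareDispersion 1 0) μ U D4Irrep.B1g ∧
        channelInf (squareDispersion 1 0) μ U D4Irrep.B1g ≤ -((a : ℚ) : ℝ) * U ^ 2 := by
  obtain ⟨⟨hm4, -, hm0, -⟩, -, -⟩ := klb1gd_coverLogic c hc
  intro μ hμ U
  have hmo : μ ∈ Set.Ioo (-4 : ℝ) 0 :=
    ⟨lt_of_lt_of_le (by exact_mod_cast hm4) hμ.1, lt_of_le_of_lt hμ.2 (by exact_mod_cast hm0)⟩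
  have hfin : IsFiniteMeasure (fermiCurveMeasure (squareDispersion 1 0) μ) :=
    stub_klFiniteMeasure stub_klGradient stub_klHausdorffFinite μ hmo
  have hinv := stub_klD4Invariant stub_klGradient μ hmo
  have hhom : channelInf (squareDispersion 1 0) μ U D4Irrep.B1g =
      U ^ 2 * channelInf (squareDispersion 1 0) μ 1 D4Irrep.B1g :=
    klhs_channelInf_sq stub_klKernelHS hmo U D4Irrep.B1g
      (fun ψ hψ => (stub_klMeanZero _ _ hfin hinv D4Irrep.B1g ψ (by decide) hψ).2)
  obtain ⟨h1, h2⟩ := klb1gt_window_two_sided c hc hT a K ha hK μ hμ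
  rw [hhom]
  constructor <;> nlinarith [sq_nonneg U]

end Summit.HubbardSuperconductivity.HubbardSuperconductivity.Theorems

end
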